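import Mathlib
import HarnessLib

/-!
# Order of vanishing at a point: two-sided power bounds for a double Taylor expansion

(Line `janus-bands`, crux `ArrangementNormalForm`, stub `stub_separateTwo`, part `Order`.)
The POWER COUNTING brick of the `stub_separateTwo` roadmap at a rational point `P` of the base
plane (cases (B) at rational points, (C2), (C3)). A numerator `p` expanded twice
(`separatePos_taylor` in `λ = ỹ − ℓ(x̃)`, then each coefficient in `u = x̃ − x̃_P`) is a finite
double sum `F(u, λ) = ∑_{(i,m) ∈ T} c(i,m) u^m λ^i`; let `d` be a lower bound for `i + m` over
the nonzero coefficients (the order of `p` at `P`) and `h_d` the part with `i + m = d`. Then: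
(U) every TERM is `O((|u|+|λ|)^d)` on `|u| + |λ| ≤ 1` (`term_le`) — the bound
`|qᵢ λ^i| ≤ C r^d` for the Taylor pieces; (L) on a compact set of directions `D` missing the
zeros of `h_d`, `|F(r w)| ≥ c r^d` for `0 ≤ r ≤ r₀` (`lower_bound_on_good_directions`,
registered as `separateTwo_order`) — the GOOD SECTORS where the Taylor pieces are dominated by
`|p|`; and `|F(r w)| ≤ C r^d` (`upper_bound`).
-/

noncomputable section

open Set

namespace Summit.KontsevichZagierPeriods.ArrangementNormalForm.JanusBands

namespace SepTwo

/-- The double sum `F(u, λ) = ∑_{(i,m) ∈ T} c(i,m) u^m λ^i`. -/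
def dsum (T : Finset (ℕ × ℕ)) (c : ℕ × ℕ → ℝ) (u l : ℝ) : ℝ :=
  ∑ im ∈ T, c im * u ^ im.2 * l ^ im.1

/-- Its part of total degree `d`. -/
def dpart (T : Finset (ℕ × ℕ)) (c : ℕ × ℕ → ℝ) (d : ℕ) (u l : ℝ) : ℝ :=
  ∑ im ∈ T.filter (fun im => im.1 + im.2 = d), c im * u ^ im.2 * l ^ im.1

/-- A monomial of total degree `n ≥ d` is at most `(|u|+|λ|)^d` on `|u| + |λ| ≤ 1`. -/
theorem monomial_le {u l : ℝ} (h1 : |u| + |l| ≤ 1) {i m d : ℕ} (hd : d ≤ i + m) :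
    |u ^ m * l ^ i| ≤ (|u| + |l|) ^ d := by
  have hu : |u| ≤ |u| + |l| := le_add_of_nonneg_right (abs_nonneg _)
  have hl : |l| ≤ |u| + |l| := le_add_of_nonneg_left (abs_nonneg _)
  have h0 : 0 ≤ |u| + |l| := by positivity
  rw [abs_mul, abs_pow, abs_pow]
  calc |u| ^ m * |l| ^ i ≤ (|u| + |l|) ^ m * (|u| + |l|) ^ i :=
        mul_le_mul (pow_le_pow_left₀ (abs_nonneg _) hu m) (pow_le_pow_left₀ (abs_nonneg _) hl i)
          (by positivity) (by positivity)
    _ = (|u| + |l|) ^ (i + m) := by rw [← pow_add, Nat.add_comm]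
    _ ≤ (|u| + |l|) ^ d := pow_le_pow_of_le_one h0 h1 hd

/-- **(U) Each term is `O((|u|+|λ|)^d)`.** -/
theorem term_le (T : Finset (ℕ × ℕ)) (c : ℕ × ℕ → ℝ) (d : ℕ)
    (hd : ∀ im ∈ T, c im ≠ 0 → d ≤ im.1 + im.2) {u l : ℝ} (h1 : |u| + |l| ≤ 1)
    {im : ℕ × ℕ} (him : im ∈ T) : |c im * u ^ im.2 * l ^ im.1| ≤ |c im| * (|u| + |l|) ^ d := by
  by_cases hc : c im = 0
  · simp [hc]
  · rw [mul_assoc, abs_mul]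
    exact mul_le_mul_of_nonneg_left (monomial_le h1 (hd im him hc)) (abs_nonneg _)

/-- **Upper bound** `|F(u,λ)| ≤ (∑ |c|) (|u|+|λ|)^d` on `|u| + |λ| ≤ 1`. -/
theorem upper_bound (T : Finset (ℕ × ℕ)) (c : ℕ × ℕ → ℝ) (d : ℕ)
    (hd : ∀ im ∈ T, c im ≠ 0 → d ≤ im.1 + im.2) {u l : ℝ} (h1 : |u| + |l| ≤ 1) :
    |dsum T c u l| ≤ (∑ im ∈ T, |c im|) * (|u| + |l|) ^ d := by
  unfold dsum
  rw [Finset.sum_mul]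
  exact (Finset.abs_sum_le_sum_abs _ _).trans (Finset.sum_le_sum fun im him => term_le T c d hd h1 him)

/-- Along a ray: `F(r u, r λ) = r^d h_d(u, λ) + (higher terms)`, with the higher terms bounded by
`(∑ |c|) r^{d+1}` for `0 ≤ r ≤ 1`, `|u| + |λ| ≤ 1`. -/
theorem ray_decomp (T : Finset (ℕ × ℕ)) (c : ℕ × ℕ → ℝ) (d : ℕ)
    (hd : ∀ im ∈ T, c im ≠ 0 → d ≤ im.1 + im.2) {u l r : ℝ} (h1 : |u| + |l| ≤ 1)
    (hr0 : 0 ≤ r) (hr1 : r ≤ 1) :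
    |dsum T c (r * u) (r * l) - r ^ d * dpart T c d u l| ≤ (∑ im ∈ T, |c im|) * r ^ (d + 1) := by
  classical
  have hsplit : dsum T c (r * u) (r * l) =
      ∑ im ∈ T.filter (fun im => im.1 + im.2 = d), c im * (r * u) ^ im.2 * (r * l) ^ im.1 +
      ∑ im ∈ T.filter (fun im => ¬ im.1 + im.2 = d), c im * (r * u) ^ im.2 * (r * l) ^ im.1 := by
    unfold dsum; rw [Finset.sum_filter_add_sum_filter_not]
  have hlow : ∑ im ∈ T.filter (fun im => im.1 + im.2 = d), c im * (r * u) ^ im.2 * (r * l) ^ im.1 =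
      r ^ d * dpart T c d u l := by
    unfold dpart
    rw [Finset.mul_sum]
    refine Finset.sum_congr rfl fun im him => ?_
    have he : im.1 + im.2 = d := (Finset.mem_filter.1 him).2
    rw [mul_pow, mul_pow, ← he]; ring
  rw [hsplit, hlow, add_sub_cancel_left]
  refine (Finset.abs_sum_le_sum_abs _ _).trans ?_
  have hT : ∑ im ∈ T.filter (fun im => ¬ im.1 + im.2 = d), |c im * (r * u) ^ im.2 * (r * l) ^ im.1| ≤
      ∑ im ∈ T.filter (fun im => ¬ im.1 + im.2 = d), |c im| * r ^ (d + 1) := by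
    refine Finset.sum_le_sum fun im him => ?_
    obtain ⟨himT, hne⟩ := Finset.mem_filter.1 him
    by_cases hc : c im = 0
    · simp [hc]
    have hge : d + 1 ≤ im.1 + im.2 := by
      have := hd im himT hc; omega
    rw [mul_assoc, abs_mul]
    refine mul_le_mul_of_nonneg_left ?_ (abs_nonneg _)
    rw [mul_pow, mul_pow, show r ^ im.2 * u ^ im.2 * (r ^ im.1 * l ^ im.1) =
      r ^ (im.1 + im.2) * (u ^ im.2 * l ^ im.1) by rw [pow_add]; ring, abs_mul, abs_pow, abs_of_nonneg hr0]
    calc r ^ (im.1 + im.2) * |u ^ im.2 * l ^ im.1| ≤ r ^ (d + 1) * 1 :=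
          mul_le_mul (pow_le_pow_of_le_one hr0 hr1 hge) ((monomial_le h1 le_rfl).trans (by
            simpa using pow_le_one₀ (by positivity : 0 ≤ |u| + |l|) h1)) (abs_nonneg _) (by positivity)
      _ = r ^ (d + 1) := mul_one _
  refine hT.trans ?_
  rw [← Finset.sum_mul]
  exact mul_le_mul_of_nonneg_right (Finset.sum_le_sum_of_subset_of_nonneg (Finset.filter_subset _ _)
    fun im _ _ => abs_nonneg _) (by positivity)

/-- The degree-`d` part is continuous. -/
theorem continuous_dpart (T : Finset (ℕ × ℕ)) (c : ℕ × ℕ → ℝ) (d : ℕ) :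
    Continuous fun w : ℝ × ℝ => dpart T c d w.1 w.2 := by
  unfold dpart
  fun_prop

/-- **(L) Lower bound on good directions.** If `h_d ≠ 0` on a compact set `D` of directions with
`|u| + |λ| ≤ 1`, then `|F(r w)| ≥ c r^d` for `w ∈ D`, `0 ≤ r ≤ r₀`. -/
theorem lower_bound_on_good_directions (T : Finset (ℕ × ℕ)) (c : ℕ × ℕ → ℝ) (d : ℕ)
    (hd : ∀ im ∈ T, c im ≠ 0 → d ≤ im.1 + im.2) (D : Set (ℝ × ℝ)) (hD : IsCompact D)
    (hD1 : ∀ w ∈ D, |w.1| + |w.2| ≤ 1) (hne : ∀ w ∈ D, dpart T c d w.1 w.2 ≠ 0) :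
    ∃ c₀ > 0, ∃ r₀ > 0, ∀ w ∈ D, ∀ r ∈ Icc (0 : ℝ) r₀,
      c₀ * r ^ d ≤ |dsum T c (r * w.1) (r * w.2)| := by
  by_cases hDe : D = ∅
  · exact ⟨1, one_pos, 1, one_pos, fun w hw => by simp [hDe] at hw⟩
  obtain ⟨w₀, hw₀, hmin⟩ := hD.exists_isMinOn (nonempty_iff_ne_empty.2 hDe)
    ((continuous_dpart T c d).abs.continuousOn)
  set m₀ := |dpart T c d w₀.1 w₀.2| with hm₀
  have hm₀pos : 0 < m₀ := abs_pos.2 (hne w₀ hw₀)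
  set S := ∑ im ∈ T, |c im| with hS
  have hS0 : 0 ≤ S := Finset.sum_nonneg fun _ _ => abs_nonneg _
  refine ⟨m₀ / 2, by positivity, min 1 (m₀ / (2 * (S + 1))), by positivity, fun w hw r hr => ?_⟩
  obtain ⟨hr0, hr1⟩ := hr
  have hr1' : r ≤ 1 := hr1.trans (min_le_left _ _)
  have hr2 : r ≤ m₀ / (2 * (S + 1)) := hr1.trans (min_le_right _ _)
  have hdec := ray_decomp T c d hd (hD1 w hw) hr0 hr1'
  have hmw : m₀ ≤ |dpart T c d w.1 w.2| := hmin hw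
  have hrd : 0 ≤ r ^ d := pow_nonneg hr0 d
  -- |F| ≥ r^d |h_d| - S r^{d+1} ≥ r^d (m₀ - S r) ≥ r^d m₀/2
  have h1 : r ^ d * m₀ - S * r ^ (d + 1) ≤ |dsum T c (r * w.1) (r * w.2)| := by
    have t := abs_sub_abs_le_abs_sub (r ^ d * dpart T c d w.1 w.2) (dsum T c (r * w.1) (r * w.2))
    rw [abs_sub_comm] at t
    rw [abs_mul, abs_of_nonneg hrd] at t
    nlinarith [mul_le_mul_of_nonneg_left hmw hrd]
  have h2 : S * r ≤ m₀ / 2 := by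
    have h3 : S * r ≤ S * (m₀ / (2 * (S + 1))) := mul_le_mul_of_nonneg_left hr2 hS0
    have h4 : S * (m₀ / (2 * (S + 1))) ≤ m₀ / 2 := by
      rw [mul_div_assoc', div_le_div_iff₀ (by positivity) (by positivity)]
      nlinarith
    exact h3.trans h4
  calc m₀ / 2 * r ^ d ≤ r ^ d * m₀ - S * r ^ (d + 1) := by
        rw [pow_succ]; nlinarith [mul_le_mul_of_nonneg_left h2 hrd]
    _ ≤ |dsum T c (r * w.1) (r * w.2)| := h1

end SepTwo

/-- **Lower power bound on good directions** (registered sub-goal of `stub_separateTwo`; literal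
form of `SepTwo.lower_bound_on_good_directions` with `dsum`/`dpart` spelled out): for a finite
double sum `F(u,λ) = ∑ c(i,m) u^m λ^i` whose nonzero coefficients have `i + m ≥ d`, and a compact
set `D` of directions (`|u| + |λ| ≤ 1`) on which the degree-`d` part does not vanish, there are
`c₀, r₀ > 0` with `c₀ r^d ≤ |F(r w)|` for `w ∈ D`, `0 ≤ r ≤ r₀`. -/
theorem separateTwo_order (T : Finset (ℕ × ℕ)) (c : ℕ × ℕ → ℝ) (d : ℕ) (hd : ∀ im ∈ T, c im ≠ 0 → d ≤ im.1 + im.2) (D : Set (ℝ × ℝ)) (hD : IsCompact D) (hD1 : ∀ w ∈ D, |w.1| + |w.2| ≤ 1) (hne : ∀ w ∈ D, (∑ im ∈ T.filter (fun im => im.1 + im.2 = d), c im * w.1 ^ im.2 * w.2 ^ im.1) ≠ 0) : ∃ c₀ > 0, ∃ r₀ > 0, ∀ w ∈ D, ∀ r ∈ Set.Icc (0 : ℝ) r₀, c₀ * r ^ d ≤ |∑ im ∈ T, c im * (r * w.1) ^ im.2 * (r * w.2) ^ im.1| := by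
  exact SepTwo.lower_bound_on_good_directions T c d hd D hD hD1 hne


end Summit.KontsevichZagierPeriods.ArrangementNormalForm.JanusBands
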